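import Summits.CriticalPhenomena.PercolationContinuityZ3.Theorems.PercNearOneGluingAdditiveGluingBhkMenu
import Summits.CriticalPhenomena.PercolationContinuityZ3.Theorems.PercNearOneGluingAdditiveGluingBhkSets
import HarnessLib

/-! # Crux `PercNearOneGluing.AdditiveGluing` (stmt-CriticalPhenomena-4576), line `tieline`
(skeleton v12) — stub `stub_diagPtTwo_c7` (BHK Thm. 1.3 diagonal atom, `S = {s, t}`, `X = {x}`,
"ANY" literal on the `o` side against the POINT literal `{s ↔ b}`)

Helper file for the crux skeleton of the line `tieline` (lead
prover-line-stmt-CriticalPhenomena-4576-c7-0): proves exactly the registered stub signature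
`stub_diagPtTwo_c7`; lands with `--supports stmt-CriticalPhenomena-4576`.

## Content

Finite weighted graph on `Fin n` (`μ = prodBernoulli w` on `BondConfig (Fin n)`, events
`{u ↔ v} = openConn u v`), two relays `s, t` both different from `x`, points `o, b`, and the
decreasing separation event `N := {s ↮ x} ∩ {t ↮ x} = (openConn s x)ᶜ ∩ (openConn t x)ᶜ`
(the cluster `C_{{s,t}} = C_s ∪ C_t` does not contain `x`).  Then

`μ(N ∩ ({s ↔ o} ∪ {t ↔ o})) · μ(N ∩ {s ↔ b}) ≤ μ(N) · μ(N ∩ (({s ↔ o} ∪ {t ↔ o}) ∩ {s ↔ b}))`,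

i.e. given `N` the two increasing functions `1{o ∈ C_{{s,t}}}` and `1{s ↔ b}` of the cluster
`C_{{s,t}}` are positively correlated (van den Berg–Häggström–Kahn 2006, Thm. 1.3, for the cluster of
a vertex SET).  This is the instance `S := {s, t}`, `X := {x}`,
`𝓕 := {C | ∃ s' ∈ {s, t}, s' ↔ o in C}` (`bhkMenu_any_*`), `𝓖 := {C | s ↔ b in C}` (`bhkMenu_pt_*`, the
source point `s ∈ S`) of the landed generic menu lemma `bhkMenu_one` (file `…AdditiveGluingBhkMenu`),
whose general set-BHK hypothesis `hB1` is the first half of the landed `stub_bhkSets`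
(file `…AdditiveGluingBhkSets`), followed by the set identities
`{ω | ∀ s' ∈ {s,t}, ∀ x' ∈ {x}, s' ↮ x'} = N` and `⋃_{s' ∈ {s,t}} {s' ↔ o} = {s ↔ o} ∪ {t ↔ o}`.
-/

namespace Summit.CriticalPhenomena.PercolationContinuityZ3.Theorems

open MeasureTheory Set Literature.Probability.LatticeModels Literature.Probability.Percolation

noncomputable section
open Classical

/-- **BHK 2006 Thm. 1.3, diagonal atom for the cluster of `S = {s, t}` given `{s, t} ↮ x`
(ANY literal `{s ↔ o} ∪ {t ↔ o}` against the point literal `{s ↔ b}`):** for `s ≠ x`, `t ≠ x` and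
`N = {s ↮ x} ∩ {t ↮ x}`,
`μ(N ∩ ({s ↔ o} ∪ {t ↔ o})) μ(N ∩ {s ↔ b}) ≤ μ(N) μ(N ∩ (({s ↔ o} ∪ {t ↔ o}) ∩ {s ↔ b}))`
— the instance `S := {s, t}`, `X := {x}` of the landed `bhkMenu_one` with `hB1 := stub_bhkSets.1`.
[cite: VandenbergHaggstromKahn2005, Thm. 1.3 (p. 6)] -/
theorem stub_diagPtTwo_c7 : ∀ (n : ℕ) (w : Sym2 (Fin n) → unitInterval) (s t x o b : Fin n), s ≠ x → t ≠ x → (prodBernoulli w).real ((openConn s x)ᶜ ∩ (openConn t x)ᶜ ∩ (openConn s o ∪ openConn t o)) * (prodBernoulli w).real ((openConn s x)ᶜ ∩ (openConn t x)ᶜ ∩ openConn s b) ≤ (prodBernoulli w).real ((openConn s x)ᶜ ∩ (openConn t x)ᶜ) * (prodBernoulli w).real ((openConn s x)ᶜ ∩ (openConn t x)ᶜ ∩ ((openConn s o ∪ openConn t o) ∩ openConn s b)) := by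
  intro n w s t x o b hsx htx
  -- adapted from `bhkMenu_one_conj_example` (…BhkMenu) and `stub_crossAnyOneTwo_c7` (…CrossAnyOneTwo)
  have hSX : ∀ s' ∈ ({s, t} : Finset (Fin n)), s' ∉ ({x} : Set (Fin n)) := by
    intro s' hs'
    simp only [Finset.mem_insert, Finset.mem_singleton] at hs'
    rcases hs' with rfl | rfl
    · simpa only [Set.mem_singleton_iff] using hsx
    · simpa only [Set.mem_singleton_iff] using htx
  have hs : s ∈ ({s, t} : Finset (Fin n)) := Finset.mem_insert_self s {t}
  have hO : (⋃ s' ∈ ({s, t} : Finset (Fin n)), openConn s' o : Set (BondConfig (Fin n))) =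
      openConn s o ∪ openConn t o := by
    rw [Finset.set_biUnion_insert, Finset.set_biUnion_singleton]
  have key := bhkMenu_one stub_bhkSets.1 w ({s, t} : Finset (Fin n)) ({x} : Set (Fin n))
    {C : Set (Sym2 (Fin n)) | ∃ s' ∈ ({s, t} : Finset (Fin n)), (openGraph C).Reachable s' o}
    {C : Set (Sym2 (Fin n)) | (openGraph C).Reachable s b}
    (bhkMenu_any_isUpperSet {s, t} o) (bhkMenu_pt_isUpperSet s b)
    (openConn s o ∪ openConn t o) (openConn s b)
    (fun ω => by rw [← hO]; exact bhkMenu_any_mem {s, t} o ω)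
    (fun ω => bhkMenu_pt_mem {s, t} hs b ω) hSX
  have hD : {ω : BondConfig (Fin n) | ∀ s' ∈ ({s, t} : Finset (Fin n)), ∀ x' ∈ ({x} : Set (Fin n)),
      ¬ (openGraph ω).Reachable s' x'} = (openConn s x)ᶜ ∩ (openConn t x)ᶜ := by
    ext ω
    simp only [Finset.mem_insert, Finset.mem_singleton, Set.mem_singleton_iff, forall_eq_or_imp,
      forall_eq, Set.mem_setOf_eq, Set.mem_inter_iff, Set.mem_compl_iff, openConn]
  rw [hD] at key
  exact key

end

end Summit.CriticalPhenomena.PercolationContinuityZ3.Theorems
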